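import Summits.CriticalPhenomena.PercolationContinuityZ3.Theorems.PercNearOneGluingNoHeavyLowerTailKnQuestion8CoefficientwiseCoreClassKernelMixMergedScheme
import Summits.CriticalPhenomena.PercolationContinuityZ3.Theorems.PercNearOneGluingNoHeavyLowerTailKnQuestion8CoefficientwiseCoreClassKernelMixBundleFibreTransfer
import HarnessLib

/-!
# Boundary inequality on bundles, XV: fibre schemes INSIDE one red-prefix class of a thread

Support file (`--supports stmt-CriticalPhenomena-4575`, closed), prover `prim-cplus-coupling` (gen 59).  No definitions, no notations, no named facts,
no sorries; standard axioms.  Memo `prim-cplus-coupling/A5-COUPLING-gen59.md` §1 (THEOREM CT, the clean-thread theorem).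

SETTING.  An explicit bundle `Θ(ℓ₁..ℓ_r)` as in `…KernelMixBundleBoundary` (threads `t < r`, edges `e t j`, edge sets `A t`, `E = ⋃ A t`, `C ω = C_u(ω)`),
an up-closed event `𝒱`, monotone `{0,1}`-valued levels `hᵃ, hᵇ, kᵃ, kᵇ`; DEMAND `b ∈ C(E∖σ) ∖ C σ`, SUPPLY `b ∈ C λ ∖ C(E∖λ)`; statuses
`bad₁ = hro ∧ kbo`, `L₁ = hᵃX = kᵇX = 1, hᵇY = kᵃY = 0` (type 2 with `h ↔ k`).  For a thread `z` and `1 ≤ a ≤ L z − 1` the RED-PREFIX CLASS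
`R_a(z) = {ω : e z 1, …, e z a ∈ ω, e z (a+1) ∉ ω}` (the `z`-word is `R^a B ·`).  Two Harris/Kleitman counts confined to one class:
* `Coefficientwise.bundle_class_merged_count` — the merged scheme inside the class: `#{σ ∈ R_a(z) : 𝒱, demand, hro, kbo} ≤ #{λ ∈ R_a(z) : 𝒱, supply, L₁}`
  (Harris on the class cube = the prefix-`a` fibre of the frozen thread `z`, all other coordinates complemented; the landing IS the target);
* `Coefficientwise.bundle_class_slab_count` — the slab scheme inside the class: for a slab thread `t` and a further prefix-frozen thread `q` (every counted source
  with `t` blue starts red on `q`), `#{σ ∈ R_a(z) : A t ∩ σ = ∅, 𝒱, demand, hro, kbo} ≤ #{λ ∈ R_a(z) : A t ⊆ λ, e q 1 ∈ λ, ¬A q ⊆ λ, 𝒱(λ∖A t), hro(λ∖A t),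
  supply, L₁}`.
Both are instances of the abstract `fibre_system_count` (…KernelMixMergedScheme) with the class restriction folded into the increasing predicate (`e z j ∈ ·`,
`j ≤ a`) and the decreasing one (`e z (a+1) ∉ ·`); the transfer is `bundle_fibre_transfer`.  They are the two per-class certificates of THEOREM CT
(`…KernelMixBundleCleanThread`).  [cite: KozmaNitzan2024, Questions 8–9 (§5.5 p. 36) (context); Harris 1960]
-/

namespace Summit.CriticalPhenomena.PercolationContinuityZ3.Theorems

open Finset Literature.Probability.Percolation

namespace Coefficientwise

variable {ι V : Type*}

open Classical in
/-- **Merged scheme inside a red-prefix class.**  Explicit bundle, thread `z` with a class index `1 ≤ a`, `a + 1 ≤ L z`, and another thread `q ≠ z`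
(bookkeeping only).  Then `#{σ ⊆ E : σ ∈ R_a(z), 𝒱, demand, hro, kbo} ≤ #{λ ⊆ E : λ ∈ R_a(z), 𝒱, supply, L₁}`.  Memo gen 59 §1 (case (i) of the class
argument).  [cite: KozmaNitzan2024, Questions 8–9 (§5.5 p. 36) (context); Harris 1960] -/
theorem bundle_class_merged_count (ends : ι → Sym2 V) (r : ℕ) (L : ℕ → ℕ) (hL : ∀ t, t < r → 1 ≤ L t)
    (w : ℕ → ℕ → V) (e : ℕ → ℕ → ι) (u b : V)
    (hw0 : ∀ t, t < r → w t 0 = u) (hwL : ∀ t, t < r → w t (L t) = b)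
    (harc : ∀ t, t < r → ∀ j, 1 ≤ j → j ≤ L t → ends (e t j) = s(w t (j - 1), w t j))
    (hwinj : ∀ t, t < r → ∀ i j, i ≤ L t → j ≤ L t → w t i = w t j → i = j)
    (hcross : ∀ t t', t < r → t' < r → t ≠ t' → ∀ i j, i ≤ L t → j ≤ L t' → w t i = w t' j → (i = 0 ∧ j = 0) ∨ (i = L t ∧ j = L t'))
    (A : ℕ → Finset ι) (hA : ∀ t, t < r → ∀ i, i ∈ A t ↔ ∃ j, 1 ≤ j ∧ j ≤ L t ∧ e t j = i)
    (hAdisj : ∀ t t', t < r → t' < r → t ≠ t' → Disjoint (A t) (A t'))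
    (E : Finset ι) (hEA : ∀ i, i ∈ E ↔ ∃ t, t < r ∧ i ∈ A t)
    (z q : ℕ) (hz : z < r) (hq : q < r) (hzq : z ≠ q) (a : ℕ) (ha1 : 1 ≤ a) (haL : a + 1 ≤ L z)
    (𝒱 : Finset ι → Prop) (hV : ∀ ⦃s t : Finset ι⦄, s ⊆ t → 𝒱 s → 𝒱 t)
    (ha hb ka kb : Set V → ℝ) (mha : Monotone ha) (mhb : Monotone hb) (mka : Monotone ka) (mkb : Monotone kb)
    (ha01 : ∀ S, ha S = 0 ∨ ha S = 1) (hb01 : ∀ S, hb S = 0 ∨ hb S = 1) (ka01 : ∀ S, ka S = 0 ∨ ka S = 1) (kb01 : ∀ S, kb S = 0 ∨ kb S = 1) :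
    ((E.powerset).filter (fun σ => ((∀ j, 1 ≤ j → j ≤ a → e z j ∈ σ) ∧ e z (a + 1) ∉ σ) ∧ 𝒱 σ ∧
        (b ∈ openCluster (ends '' (↑(E \ σ) : Set ι)) u ∧ b ∉ openCluster (ends '' (↑σ : Set ι)) u) ∧
        (ha (openCluster (ends '' (↑σ : Set ι)) u) = 1 ∧ hb (openCluster (ends '' (↑(E \ σ) : Set ι)) u) = 0) ∧
        (kb (openCluster (ends '' (↑(E \ σ) : Set ι)) u) = 1 ∧ ka (openCluster (ends '' (↑σ : Set ι)) u) = 0))).card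
    ≤ ((E.powerset).filter (fun lam => ((∀ j, 1 ≤ j → j ≤ a → e z j ∈ lam) ∧ e z (a + 1) ∉ lam) ∧ 𝒱 lam ∧
        (b ∈ openCluster (ends '' (↑lam : Set ι)) u ∧ b ∉ openCluster (ends '' (↑(E \ lam) : Set ι)) u) ∧
        (ha (openCluster (ends '' (↑lam : Set ι)) u) = 1 ∧ kb (openCluster (ends '' (↑lam : Set ι)) u) = 1 ∧
          hb (openCluster (ends '' (↑(E \ lam) : Set ι)) u) = 0 ∧ ka (openCluster (ends '' (↑(E \ lam) : Set ι)) u) = 0))).card := by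
  set C : Finset ι → Set V := fun ω => openCluster (ends '' (↑ω : Set ι)) u with hC
  -- ## bundle bookkeeping
  have hr : 0 < r := lt_of_le_of_lt (Nat.zero_le z) hz
  have hAE : ∀ t, t < r → A t ⊆ E := fun t ht i hi => (hEA i).mpr ⟨t, ht, hi⟩
  have heA : ∀ t, t < r → ∀ j, 1 ≤ j → j ≤ L t → e t j ∈ A t := fun t ht j hj1 hjL => (hA t ht _).mpr ⟨j, hj1, hjL, rfl⟩
  have full_iff : ∀ ω : Finset ι, ω ⊆ E → (b ∈ C ω ↔ ∃ t, t < r ∧ A t ⊆ ω) := fun ω hω =>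
    bundle_b_mem_cluster_iff_threads ends r L hL w e u b hr hw0 hwL harc hwinj hcross A hA E hEA ω hω
  have einj : ∀ t, t < r → ∀ i j, 1 ≤ i → i ≤ L t → 1 ≤ j → j ≤ L t → e t i = e t j → i = j := by
    intro t ht i j hi1 hiL hj1 hjL hij
    have h := harc t ht i hi1 hiL
    rw [hij, harc t ht j hj1 hjL] at h
    rcases Sym2.eq_iff.mp h with ⟨h1, _⟩ | ⟨h1, h2⟩
    · have := hwinj t ht (j - 1) (i - 1) (by omega) (by omega) h1; omega
    · have e1 := hwinj t ht (j - 1) i (by omega) hiL h1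
      have e2 := hwinj t ht j (i - 1) hjL (by omega) h2
      omega
  -- 0/1 bookkeeping
  have one_of_ge : ∀ (f : Set V → ℝ), (∀ S, f S = 0 ∨ f S = 1) → ∀ S S' : Set V, S ⊆ S' → Monotone f → f S = 1 → f S' = 1 := by
    intro f f01 S S' hSS' mf h1
    rcases f01 S' with h0 | h0
    · have := mf hSS'; rw [h1, h0] at this; linarith
    · exact h0
  have zero_of_le : ∀ (f : Set V → ℝ), (∀ S, f S = 0 ∨ f S = 1) → ∀ S S' : Set V, S ⊆ S' → Monotone f → f S' = 0 → f S = 0 := by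
    intro f f01 S S' hSS' mf h0
    rcases f01 S with h1 | h1
    · exact h1
    · have := mf hSS'; rw [h1, h0] at this; linarith
  have Cmono : ∀ s t : Finset ι, s ⊆ t → C s ⊆ C t := fun s t hst => openCluster_image_mono ends hst u
  have Ccompl : ∀ s t : Finset ι, s ⊆ t → C (E \ t) ⊆ C (E \ s) := fun s t hst => Cmono _ _ (Finset.sdiff_subset_sdiff (le_refl E) hst)
  -- ## the predicates: the class restriction is folded into the event (lower half) and into kbo (upper half)
  have V'_mono : ∀ s t : Finset ι, s ⊆ t → (𝒱 s ∧ ∀ j, 1 ≤ j → j ≤ a → e z j ∈ s) → (𝒱 t ∧ ∀ j, 1 ≤ j → j ≤ a → e z j ∈ t) :=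
    fun s t hst hs => ⟨hV hst hs.1, fun j hj1 hja => hst (hs.2 j hj1 hja)⟩
  have hro_mono : ∀ s t : Finset ι, s ⊆ t → (ha (C s) = 1 ∧ hb (C (E \ s)) = 0) → (ha (C t) = 1 ∧ hb (C (E \ t)) = 0) := by
    intro s t hst hs
    exact ⟨one_of_ge ha ha01 _ _ (Cmono s t hst) mha hs.1, zero_of_le hb hb01 _ _ (Ccompl s t hst) mhb hs.2⟩
  have kbo_anti : ∀ s t : Finset ι, s ⊆ t → ((kb (C (E \ t)) = 1 ∧ ka (C t) = 0) ∧ e z (a + 1) ∉ t) →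
      ((kb (C (E \ s)) = 1 ∧ ka (C s) = 0) ∧ e z (a + 1) ∉ s) := by
    intro s t hst ht
    exact ⟨⟨one_of_ge kb kb01 _ _ (Ccompl s t hst) mkb ht.1.1, zero_of_le ka ka01 _ _ (Cmono s t hst) mka ht.1.2⟩, fun hm => ht.2 (hst hm)⟩
  have N_anti : ∀ s t : Finset ι, s ⊆ t → (b ∈ C (E \ t) ∧ b ∉ C t) → (b ∈ C (E \ s) ∧ b ∉ C s) := by
    intro s t hst ht
    exact ⟨Ccompl s t hst ht.1, fun hm => ht.2 (Cmono s t hst hm)⟩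
  have hNPQ : ∀ σ, σ ⊆ E → (b ∈ C (E \ σ) ∧ b ∉ C σ) → ¬ A z ⊆ σ ∧ ¬ A q ⊆ σ := by
    intro σ hσ hN
    exact ⟨fun hsub => hN.2 ((full_iff σ hσ).mpr ⟨z, hz, hsub⟩), fun hsub => hN.2 ((full_iff σ hσ).mpr ⟨q, hq, hsub⟩)⟩
  have hSQne : ({0} : Finset ℕ) ≠ Finset.Icc 1 (L q - 1) := by
    intro h
    have : (0 : ℕ) ∈ Finset.Icc 1 (L q - 1) := by rw [← h]; exact Finset.mem_singleton_self 0
    rw [Finset.mem_Icc] at this; omega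
  have covP : Finset.Icc 1 (L z - 1) = Finset.Icc 1 (L z - 1) → ∀ σ, σ ⊆ E → ((𝒱 σ ∧ ∀ j, 1 ≤ j → j ≤ a → e z j ∈ σ) ∧ (b ∈ C (E \ σ) ∧ b ∉ C σ) ∧
      (ha (C σ) = 1 ∧ hb (C (E \ σ)) = 0) ∧ ((kb (C (E \ σ)) = 1 ∧ ka (C σ) = 0) ∧ e z (a + 1) ∉ σ)) → e z 1 ∈ σ :=
    fun _ σ _ hs => hs.1.2 1 (le_refl 1) ha1
  have covQ : ({0} : Finset ℕ) = Finset.Icc 1 (L q - 1) → ∀ σ, σ ⊆ E → ((𝒱 σ ∧ ∀ j, 1 ≤ j → j ≤ a → e z j ∈ σ) ∧ (b ∈ C (E \ σ) ∧ b ∉ C σ) ∧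
      (ha (C σ) = 1 ∧ hb (C (E \ σ)) = 0) ∧ ((kb (C (E \ σ)) = 1 ∧ ka (C σ) = 0) ∧ e z (a + 1) ∉ σ)) → e q 1 ∈ σ :=
    fun h => absurd h hSQne
  -- ## transfer: a landing is an L₁-supply point of 𝒱 in the class
  have transfer : ∀ i c : ℕ, i ∈ Finset.Icc 1 (L z - 1) → c ∈ ({0} : Finset ℕ) → i < L z → c < L q → ∀ ξ ρ : Finset ι, ξ ⊆ E → ρ ⊆ E →
      (∀ j, 1 ≤ j → j ≤ i → e z j ∈ ξ ∧ e z j ∈ ρ) → (1 ≤ i → e z (i + 1) ∉ ξ ∧ e z (i + 1) ∉ ρ) →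
      (∀ j, 1 ≤ j → j ≤ L z → (i = 0 ∨ i + 2 ≤ j) → (e z j ∈ ρ ↔ e z j ∉ ξ)) →
      (∀ j, 1 ≤ j → j ≤ c → e q j ∈ ξ ∧ e q j ∈ ρ) → (1 ≤ c → e q (c + 1) ∉ ξ ∧ e q (c + 1) ∉ ρ) →
      (∀ j, 1 ≤ j → j ≤ L q → (c = 0 ∨ c + 2 ≤ j) → (e q j ∈ ρ ↔ e q j ∉ ξ)) →
      (∀ x, x ∈ E → x ∉ A z → x ∉ A q → (x ∈ ρ ↔ x ∉ ξ)) →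
      (𝒱 ξ ∧ ∀ j, 1 ≤ j → j ≤ a → e z j ∈ ξ) → (ha (C ξ) = 1 ∧ hb (C (E \ ξ)) = 0) →
      ((kb (C (E \ ρ)) = 1 ∧ ka (C ρ) = 0) ∧ e z (a + 1) ∉ ρ) → (b ∈ C (E \ ρ) ∧ b ∉ C ρ) →
      (((∀ j, 1 ≤ j → j ≤ a → e z j ∈ ξ) ∧ e z (a + 1) ∉ ξ) ∧ 𝒱 ξ ∧ (b ∈ C ξ ∧ b ∉ C (E \ ξ)) ∧
        (ha (C ξ) = 1 ∧ kb (C ξ) = 1 ∧ hb (C (E \ ξ)) = 0 ∧ ka (C (E \ ξ)) = 0)) := by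
    intro i c hiS hcS hiL hcL ξ ρ hξ hρ hPa hPa1 hPfree hQc hQc1 hQfree hrest hv hh hk hN
    have hi1 : 1 ≤ i := by rw [Finset.mem_Icc] at hiS; exact hiS.1
    have hc0 : c = 0 := Finset.mem_singleton.mp hcS
    -- the fibre prefix is the class prefix
    have hia : i = a := by
      rcases Nat.lt_trichotomy i a with hlt | heq | hgt
      · exact absurd (hv.2 (i + 1) (by omega) (by omega)) (hPa1 hi1).1
      · exact heq
      · exact absurd (hPa (a + 1) (by omega) (by omega)).2 hk.2
    subst hia
    -- kinds: every thread PREFIX/FREE (κ = 2), lengths i on z, 0 elsewhere; no lift (lam = ξ)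
    obtain ⟨κ, hκ⟩ : ∃ f : ℕ → ℕ, f = fun _ => 2 := ⟨_, rfl⟩
    obtain ⟨al, hal⟩ : ∃ f : ℕ → ℕ, f = fun t => if t = z then i else 0 := ⟨_, rfl⟩
    have halz : al z = i := by rw [hal]; simp
    have halo : ∀ t, t ≠ z → al t = 0 := by intro t htz; rw [hal]; simp [htz]
    have hnf : ∀ t, t < r → ∃ j, 1 ≤ j ∧ j ≤ L t ∧ e t j ∉ ρ := by
      intro t ht
      by_contra hno
      push Not at hno
      exact hN.2 ((full_iff ρ hρ).mpr ⟨t, ht, fun x hx => by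
        obtain ⟨j, hj1, hjL, rfl⟩ := (hA t ht x).mp hx
        exact hno j hj1 hjL⟩)
    have hempty : ∃ t, t < r ∧ ∀ j, 1 ≤ j → j ≤ L t → e t j ∉ ρ := by
      obtain ⟨t, ht, hsub⟩ := (full_iff (E \ ρ) Finset.sdiff_subset).mp hN.1
      exact ⟨t, ht, fun j hj1 hjL => (Finset.mem_sdiff.mp (hsub (heA t ht j hj1 hjL))).2⟩
    have key := bundle_fibre_transfer ends r L hL w e u b hw0 hwL harc hwinj hcross A hA E hEA κ al ξ ρ ξ hξ
      (fun t ht j hj1 hjL => by rw [hκ]; simp)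
      (fun t ht h1 => by rw [hκ] at h1; exact absurd h1 (by norm_num))
      (fun t ht _ => by
        by_cases htz : t = z
        · subst htz; rw [halz]; exact ⟨hiL, hPa, hPa1, hPfree⟩
        rw [halo t htz]
        refine ⟨Nat.lt_of_lt_of_le Nat.zero_lt_one (hL t ht), fun j hj1 hj0 => by omega, fun h => by omega, fun j hj1 hjL _ => ?_⟩
        have hx : e t j ∈ E := hAE t ht (heA t ht j hj1 hjL)
        by_cases htq : t = q
        · subst htq; exact hQfree j hj1 hjL (Or.inl hc0)
        exact hrest (e t j) hx (fun hm => Finset.disjoint_left.mp (hAdisj t z ht hz htz) (heA t ht j hj1 hjL) hm)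
          (fun hm => Finset.disjoint_left.mp (hAdisj t q ht hq htq) (heA t ht j hj1 hjL) hm))
      (fun t ht => by rw [hκ]; exact Or.inr (Or.inr rfl)) hnf hempty
    obtain ⟨hbX, hbY, T2, T3⟩ := key
    exact ⟨⟨hv.2, (hPa1 hi1).1⟩, hv.1, ⟨hbX, hbY⟩, ⟨hh.1, one_of_ge kb kb01 _ _ T2 mkb hk.1.1, hh.2, zero_of_le ka ka01 _ _ T3 mka hk.1.2⟩⟩
  -- ## the abstract theorem
  have key := fibre_system_count E (A z) (A q) (hAE z hz) (hAE q hq) (hAdisj z q hz hq hzq) (L z) (L q) (hL z hz) (hL q hq) (e z) (e q)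
    (heA z hz) (einj z hz) (fun x hx => (hA z hz x).mp hx) (heA q hq) (einj q hq) (fun x hx => (hA q hq x).mp hx)
    (fun ξ => 𝒱 ξ ∧ ∀ j, 1 ≤ j → j ≤ a → e z j ∈ ξ) (fun ξ => ha (C ξ) = 1 ∧ hb (C (E \ ξ)) = 0)
    (fun ξ => (kb (C (E \ ξ)) = 1 ∧ ka (C ξ) = 0) ∧ e z (a + 1) ∉ ξ)
    (fun ξ => b ∈ C (E \ ξ) ∧ b ∉ C ξ)
    (fun lam => ((∀ j, 1 ≤ j → j ≤ a → e z j ∈ lam) ∧ e z (a + 1) ∉ lam) ∧ 𝒱 lam ∧ (b ∈ C lam ∧ b ∉ C (E \ lam)) ∧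
      (ha (C lam) = 1 ∧ kb (C lam) = 1 ∧ hb (C (E \ lam)) = 0 ∧ ka (C (E \ lam)) = 0))
    V'_mono hro_mono kbo_anti N_anti hNPQ (Finset.Icc 1 (L z - 1)) {0} (Or.inr rfl) (Or.inl rfl) covP covQ transfer
  -- the source sets agree
  have e1 : (E.powerset).filter (fun σ => ((∀ j, 1 ≤ j → j ≤ a → e z j ∈ σ) ∧ e z (a + 1) ∉ σ) ∧ 𝒱 σ ∧ (b ∈ C (E \ σ) ∧ b ∉ C σ) ∧
      (ha (C σ) = 1 ∧ hb (C (E \ σ)) = 0) ∧ (kb (C (E \ σ)) = 1 ∧ ka (C σ) = 0)) =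
      (E.powerset).filter (fun σ => (𝒱 σ ∧ ∀ j, 1 ≤ j → j ≤ a → e z j ∈ σ) ∧ (b ∈ C (E \ σ) ∧ b ∉ C σ) ∧
        (ha (C σ) = 1 ∧ hb (C (E \ σ)) = 0) ∧ ((kb (C (E \ σ)) = 1 ∧ ka (C σ) = 0) ∧ e z (a + 1) ∉ σ)) := by
    apply Finset.filter_congr
    intro σ _
    constructor
    · rintro ⟨⟨hcl, hna⟩, hv, hN, hh, hk⟩; exact ⟨⟨hv, hcl⟩, hN, hh, hk, hna⟩
    · rintro ⟨⟨hv, hcl⟩, hN, hh, hk, hna⟩; exact ⟨⟨hcl, hna⟩, hv, hN, hh, hk⟩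
  have e2 : ((E.powerset).filter (fun σ => ((∀ j, 1 ≤ j → j ≤ a → e z j ∈ σ) ∧ e z (a + 1) ∉ σ) ∧ 𝒱 σ ∧ (b ∈ C (E \ σ) ∧ b ∉ C σ) ∧
      (ha (C σ) = 1 ∧ hb (C (E \ σ)) = 0) ∧ (kb (C (E \ σ)) = 1 ∧ ka (C σ) = 0))).card ≤
      ((E.powerset).filter (fun lam => ((∀ j, 1 ≤ j → j ≤ a → e z j ∈ lam) ∧ e z (a + 1) ∉ lam) ∧ 𝒱 lam ∧ (b ∈ C lam ∧ b ∉ C (E \ lam)) ∧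
      (ha (C lam) = 1 ∧ kb (C lam) = 1 ∧ hb (C (E \ lam)) = 0 ∧ ka (C (E \ lam)) = 0))).card := by
    rw [e1]; convert key using 3
  convert e2 using 3

open Classical in
/-- **Slab scheme inside a red-prefix class.**  Explicit bundle, slab thread `t`, a prefix-frozen thread `q` and the class thread `z` (pairwise distinct),
class index `1 ≤ a`, `a + 1 ≤ L z`.  If every counted source (class `R_a(z)`, `t` blue, `𝒱`, demand, hro, kbo) starts red on `q` (`covq`), then
`#{σ ⊆ E : A t ∩ σ = ∅, σ ∈ R_a(z), 𝒱, demand, hro, kbo} ≤ #{λ ⊆ E : A t ⊆ λ, λ ∈ R_a(z), e q 1 ∈ λ, ¬ A q ⊆ λ, 𝒱 (λ∖A t), hro (λ∖A t), supply, L₁}`.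
Memo gen 59 §1 (case (ii) of the class argument).  [cite: KozmaNitzan2024, Questions 8–9 (§5.5 p. 36) (context); Harris 1960] -/
theorem bundle_class_slab_count (ends : ι → Sym2 V) (r : ℕ) (L : ℕ → ℕ) (hL : ∀ t, t < r → 1 ≤ L t)
    (w : ℕ → ℕ → V) (e : ℕ → ℕ → ι) (u b : V)
    (hw0 : ∀ t, t < r → w t 0 = u) (hwL : ∀ t, t < r → w t (L t) = b)
    (harc : ∀ t, t < r → ∀ j, 1 ≤ j → j ≤ L t → ends (e t j) = s(w t (j - 1), w t j))
    (hwinj : ∀ t, t < r → ∀ i j, i ≤ L t → j ≤ L t → w t i = w t j → i = j)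
    (hcross : ∀ t t', t < r → t' < r → t ≠ t' → ∀ i j, i ≤ L t → j ≤ L t' → w t i = w t' j → (i = 0 ∧ j = 0) ∨ (i = L t ∧ j = L t'))
    (A : ℕ → Finset ι) (hA : ∀ t, t < r → ∀ i, i ∈ A t ↔ ∃ j, 1 ≤ j ∧ j ≤ L t ∧ e t j = i)
    (hAdisj : ∀ t t', t < r → t' < r → t ≠ t' → Disjoint (A t) (A t'))
    (E : Finset ι) (hEA : ∀ i, i ∈ E ↔ ∃ t, t < r ∧ i ∈ A t)
    (t q z : ℕ) (ht : t < r) (hq : q < r) (hz : z < r) (htq : t ≠ q) (htz : t ≠ z) (hqz : q ≠ z) (a : ℕ) (ha1 : 1 ≤ a) (haL : a + 1 ≤ L z)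
    (𝒱 : Finset ι → Prop) (hV : ∀ ⦃s t : Finset ι⦄, s ⊆ t → 𝒱 s → 𝒱 t)
    (ha hb ka kb : Set V → ℝ) (mha : Monotone ha) (mhb : Monotone hb) (mka : Monotone ka) (mkb : Monotone kb)
    (ha01 : ∀ S, ha S = 0 ∨ ha S = 1) (hb01 : ∀ S, hb S = 0 ∨ hb S = 1) (ka01 : ∀ S, ka S = 0 ∨ ka S = 1) (kb01 : ∀ S, kb S = 0 ∨ kb S = 1)
    (covq : ∀ σ, σ ⊆ E → Disjoint (A t) σ → ((∀ j, 1 ≤ j → j ≤ a → e z j ∈ σ) ∧ e z (a + 1) ∉ σ) →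
      (𝒱 σ ∧ (b ∈ openCluster (ends '' (↑(E \ σ) : Set ι)) u ∧ b ∉ openCluster (ends '' (↑σ : Set ι)) u) ∧
        (ha (openCluster (ends '' (↑σ : Set ι)) u) = 1 ∧ hb (openCluster (ends '' (↑(E \ σ) : Set ι)) u) = 0) ∧
        (kb (openCluster (ends '' (↑(E \ σ) : Set ι)) u) = 1 ∧ ka (openCluster (ends '' (↑σ : Set ι)) u) = 0)) → e q 1 ∈ σ) :
    ((E.powerset).filter (fun σ => Disjoint (A t) σ ∧ ((∀ j, 1 ≤ j → j ≤ a → e z j ∈ σ) ∧ e z (a + 1) ∉ σ) ∧ 𝒱 σ ∧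
        (b ∈ openCluster (ends '' (↑(E \ σ) : Set ι)) u ∧ b ∉ openCluster (ends '' (↑σ : Set ι)) u) ∧
        (ha (openCluster (ends '' (↑σ : Set ι)) u) = 1 ∧ hb (openCluster (ends '' (↑(E \ σ) : Set ι)) u) = 0) ∧
        (kb (openCluster (ends '' (↑(E \ σ) : Set ι)) u) = 1 ∧ ka (openCluster (ends '' (↑σ : Set ι)) u) = 0))).card
    ≤ ((E.powerset).filter (fun lam => A t ⊆ lam ∧ ((∀ j, 1 ≤ j → j ≤ a → e z j ∈ lam) ∧ e z (a + 1) ∉ lam) ∧ (e q 1 ∈ lam ∧ ¬ A q ⊆ lam) ∧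
        𝒱 (lam \ A t) ∧
        (ha (openCluster (ends '' (↑(lam \ A t) : Set ι)) u) = 1 ∧ hb (openCluster (ends '' (↑(E \ (lam \ A t)) : Set ι)) u) = 0) ∧
        (b ∈ openCluster (ends '' (↑lam : Set ι)) u ∧ b ∉ openCluster (ends '' (↑(E \ lam) : Set ι)) u) ∧
        (ha (openCluster (ends '' (↑lam : Set ι)) u) = 1 ∧ kb (openCluster (ends '' (↑lam : Set ι)) u) = 1 ∧
          hb (openCluster (ends '' (↑(E \ lam) : Set ι)) u) = 0 ∧ ka (openCluster (ends '' (↑(E \ lam) : Set ι)) u) = 0))).card := by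
  set C : Finset ι → Set V := fun ω => openCluster (ends '' (↑ω : Set ι)) u with hC
  -- ## bundle bookkeeping
  have hr : 0 < r := lt_of_le_of_lt (Nat.zero_le t) ht
  have hAE : ∀ t, t < r → A t ⊆ E := fun t ht i hi => (hEA i).mpr ⟨t, ht, hi⟩
  have heA : ∀ t, t < r → ∀ j, 1 ≤ j → j ≤ L t → e t j ∈ A t := fun t ht j hj1 hjL => (hA t ht _).mpr ⟨j, hj1, hjL, rfl⟩
  have full_iff : ∀ ω : Finset ι, ω ⊆ E → (b ∈ C ω ↔ ∃ t, t < r ∧ A t ⊆ ω) := fun ω hω =>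
    bundle_b_mem_cluster_iff_threads ends r L hL w e u b hr hw0 hwL harc hwinj hcross A hA E hEA ω hω
  have einj : ∀ t, t < r → ∀ i j, 1 ≤ i → i ≤ L t → 1 ≤ j → j ≤ L t → e t i = e t j → i = j := by
    intro t ht i j hi1 hiL hj1 hjL hij
    have h := harc t ht i hi1 hiL
    rw [hij, harc t ht j hj1 hjL] at h
    rcases Sym2.eq_iff.mp h with ⟨h1, _⟩ | ⟨h1, h2⟩
    · have := hwinj t ht (j - 1) (i - 1) (by omega) (by omega) h1; omega
    · have e1 := hwinj t ht (j - 1) i (by omega) hiL h1; have e2 := hwinj t ht j (i - 1) hjL (by omega) h2; omega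
  have one_of_ge : ∀ (f : Set V → ℝ), (∀ S, f S = 0 ∨ f S = 1) → ∀ S S' : Set V, S ⊆ S' → Monotone f → f S = 1 → f S' = 1 := by
    intro f f01 S S' hSS' mf h1
    rcases f01 S' with h0 | h0
    · have := mf hSS'; rw [h1, h0] at this; linarith
    · exact h0
  have zero_of_le : ∀ (f : Set V → ℝ), (∀ S, f S = 0 ∨ f S = 1) → ∀ S S' : Set V, S ⊆ S' → Monotone f → f S' = 0 → f S = 0 :=
    fun f f01 S S' hSS' mf h0 => (f01 S).elim id fun h1 => by have := mf hSS'; rw [h1, h0] at this; linarith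
  have Cmono : ∀ s t : Finset ι, s ⊆ t → C s ⊆ C t := fun s t hst => openCluster_image_mono ends hst u
  have Ccompl : ∀ s t : Finset ι, s ⊆ t → C (E \ t) ⊆ C (E \ s) := fun s t hst => Cmono _ _ (Finset.sdiff_subset_sdiff (le_refl E) hst)
  -- ## the predicates of the abstract theorem: event and hro at the pre-lift `λ ∖ A t` (+ lower class half), `t`-blue and the upper class half in kbo
  have V'_mono : ∀ s s' : Finset ι, s ⊆ s' → (𝒱 (s \ A t) ∧ ∀ j, 1 ≤ j → j ≤ a → e z j ∈ s) → (𝒱 (s' \ A t) ∧ ∀ j, 1 ≤ j → j ≤ a → e z j ∈ s') :=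
    fun s s' hss' hs => ⟨hV (Finset.sdiff_subset_sdiff hss' (le_refl _)) hs.1, fun j hj1 hja => hss' (hs.2 j hj1 hja)⟩
  have hro_mono : ∀ s s' : Finset ι, s ⊆ s' → (ha (C (s \ A t)) = 1 ∧ hb (C (E \ (s \ A t))) = 0) →
      (ha (C (s' \ A t)) = 1 ∧ hb (C (E \ (s' \ A t))) = 0) := by
    intro s s' hss' hs
    have hsub : s \ A t ⊆ s' \ A t := Finset.sdiff_subset_sdiff hss' (le_refl _)
    exact ⟨one_of_ge ha ha01 _ _ (Cmono _ _ hsub) mha hs.1, zero_of_le hb hb01 _ _ (Ccompl _ _ hsub) mhb hs.2⟩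
  have kbo_anti : ∀ s s' : Finset ι, s ⊆ s' → (((kb (C (E \ s')) = 1 ∧ ka (C s') = 0) ∧ Disjoint (A t) s') ∧ e z (a + 1) ∉ s') →
      (((kb (C (E \ s)) = 1 ∧ ka (C s) = 0) ∧ Disjoint (A t) s) ∧ e z (a + 1) ∉ s) := by
    intro s s' hss' hs
    exact ⟨⟨⟨one_of_ge kb kb01 _ _ (Ccompl s s' hss') mkb hs.1.1.1, zero_of_le ka ka01 _ _ (Cmono s s' hss') mka hs.1.1.2⟩,
      Finset.disjoint_of_subset_right hss' hs.1.2⟩, fun hm => hs.2 (hss' hm)⟩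
  have N_anti : ∀ s s' : Finset ι, s ⊆ s' → (b ∈ C (E \ s') ∧ b ∉ C s') → (b ∈ C (E \ s) ∧ b ∉ C s) :=
    fun s s' hss' hs => ⟨Ccompl s s' hss' hs.1, fun hm => hs.2 (Cmono s s' hss' hm)⟩
  have hNPQ : ∀ σ, σ ⊆ E → (b ∈ C (E \ σ) ∧ b ∉ C σ) → ¬ A q ⊆ σ ∧ ¬ A z ⊆ σ := fun σ hσ hN =>
    ⟨fun hsub => hN.2 ((full_iff σ hσ).mpr ⟨q, hq, hsub⟩), fun hsub => hN.2 ((full_iff σ hσ).mpr ⟨z, hz, hsub⟩)⟩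
  -- a `t`-blue colouring equals its pre-lift
  have sdiff_of_disj : ∀ σ : Finset ι, Disjoint (A t) σ → σ \ A t = σ := fun σ hd => Finset.sdiff_eq_self_of_disjoint hd.symm
  have covP' : Finset.Icc 1 (L q - 1) = Finset.Icc 1 (L q - 1) → ∀ σ, σ ⊆ E → ((𝒱 (σ \ A t) ∧ ∀ j, 1 ≤ j → j ≤ a → e z j ∈ σ) ∧ (b ∈ C (E \ σ) ∧ b ∉ C σ) ∧
      (ha (C (σ \ A t)) = 1 ∧ hb (C (E \ (σ \ A t))) = 0) ∧ (((kb (C (E \ σ)) = 1 ∧ ka (C σ) = 0) ∧ Disjoint (A t) σ) ∧ e z (a + 1) ∉ σ)) →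
      e q 1 ∈ σ := by
    intro _ σ hσ hs
    have hd := hs.2.2.2.1.2
    have h' := hs; rw [sdiff_of_disj σ hd] at h'
    exact covq σ hσ hd ⟨h'.1.2, h'.2.2.2.2⟩ ⟨h'.1.1, h'.2.1, h'.2.2.1, h'.2.2.2.1.1⟩
  have covQ' : Finset.Icc 1 (L z - 1) = Finset.Icc 1 (L z - 1) → ∀ σ, σ ⊆ E → ((𝒱 (σ \ A t) ∧ ∀ j, 1 ≤ j → j ≤ a → e z j ∈ σ) ∧ (b ∈ C (E \ σ) ∧ b ∉ C σ) ∧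
      (ha (C (σ \ A t)) = 1 ∧ hb (C (E \ (σ \ A t))) = 0) ∧ (((kb (C (E \ σ)) = 1 ∧ ka (C σ) = 0) ∧ Disjoint (A t) σ) ∧ e z (a + 1) ∉ σ)) →
      e z 1 ∈ σ := fun _ σ _ hs => hs.1.2 1 (le_refl 1) ha1
  -- ## transfer
  have transfer : ∀ i c : ℕ, i ∈ Finset.Icc 1 (L q - 1) → c ∈ Finset.Icc 1 (L z - 1) → i < L q → c < L z → ∀ ξ ρ : Finset ι, ξ ⊆ E → ρ ⊆ E →
      (∀ j, 1 ≤ j → j ≤ i → e q j ∈ ξ ∧ e q j ∈ ρ) → (1 ≤ i → e q (i + 1) ∉ ξ ∧ e q (i + 1) ∉ ρ) →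
      (∀ j, 1 ≤ j → j ≤ L q → (i = 0 ∨ i + 2 ≤ j) → (e q j ∈ ρ ↔ e q j ∉ ξ)) →
      (∀ j, 1 ≤ j → j ≤ c → e z j ∈ ξ ∧ e z j ∈ ρ) → (1 ≤ c → e z (c + 1) ∉ ξ ∧ e z (c + 1) ∉ ρ) →
      (∀ j, 1 ≤ j → j ≤ L z → (c = 0 ∨ c + 2 ≤ j) → (e z j ∈ ρ ↔ e z j ∉ ξ)) →
      (∀ x, x ∈ E → x ∉ A q → x ∉ A z → (x ∈ ρ ↔ x ∉ ξ)) →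
      (𝒱 (ξ \ A t) ∧ ∀ j, 1 ≤ j → j ≤ a → e z j ∈ ξ) → (ha (C (ξ \ A t)) = 1 ∧ hb (C (E \ (ξ \ A t))) = 0) →
      (((kb (C (E \ ρ)) = 1 ∧ ka (C ρ) = 0) ∧ Disjoint (A t) ρ) ∧ e z (a + 1) ∉ ρ) →
      (b ∈ C (E \ ρ) ∧ b ∉ C ρ) →
      (A t ⊆ ξ ∧ ((∀ j, 1 ≤ j → j ≤ a → e z j ∈ ξ) ∧ e z (a + 1) ∉ ξ) ∧ (e q 1 ∈ ξ ∧ ¬ A q ⊆ ξ) ∧ 𝒱 (ξ \ A t) ∧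
        (ha (C (ξ \ A t)) = 1 ∧ hb (C (E \ (ξ \ A t))) = 0) ∧ (b ∈ C ξ ∧ b ∉ C (E \ ξ)) ∧
        (ha (C ξ) = 1 ∧ kb (C ξ) = 1 ∧ hb (C (E \ ξ)) = 0 ∧ ka (C (E \ ξ)) = 0)) := by
    intro i c hiS hcS hiL hcL ξ ρ hξ hρ hPa hPa1 hPfree hQc hQc1 hQfree hrest hv hh hk hN
    have hi1 : 1 ≤ i := by rw [Finset.mem_Icc] at hiS; exact hiS.1
    have hc1 : 1 ≤ c := by rw [Finset.mem_Icc] at hcS; exact hcS.1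
    -- the fibre prefix on `z` is the class prefix
    have hca : c = a := by
      rcases Nat.lt_trichotomy c a with hlt | heq | hgt
      · exact absurd (hv.2 (c + 1) (by omega) (by omega)) (hQc1 hc1).1
      · exact heq
      · exact absurd (hQc (a + 1) (by omega) (by omega)).2 hk.2
    subst hca
    obtain ⟨κ, hκ⟩ : ∃ f : ℕ → ℕ, f = fun _ => 2 := ⟨_, rfl⟩
    obtain ⟨al, hal⟩ : ∃ f : ℕ → ℕ, f = fun t => if t = q then i else if t = z then c else 0 := ⟨_, rfl⟩
    have halq : al q = i := by rw [hal]; simp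
    have halz : al z = c := by rw [hal]; simp [hqz.symm]
    have halo : ∀ t, t ≠ q → t ≠ z → al t = 0 := by intro t htq htz; rw [hal]; simp [htq, htz]
    have hnf : ∀ t, t < r → ∃ j, 1 ≤ j ∧ j ≤ L t ∧ e t j ∉ ρ := by
      intro t ht
      by_contra hno
      push Not at hno
      exact hN.2 ((full_iff ρ hρ).mpr ⟨t, ht, fun x hx => by
        obtain ⟨j, hj1, hjL, rfl⟩ := (hA t ht x).mp hx
        exact hno j hj1 hjL⟩)
    have hempty : ∃ t, t < r ∧ ∀ j, 1 ≤ j → j ≤ L t → e t j ∉ ρ := by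
      obtain ⟨t, ht, hsub⟩ := (full_iff (E \ ρ) Finset.sdiff_subset).mp hN.1
      exact ⟨t, ht, fun j hj1 hjL => (Finset.mem_sdiff.mp (hsub (heA t ht j hj1 hjL))).2⟩
    have key := bundle_fibre_transfer ends r L hL w e u b hw0 hwL harc hwinj hcross A hA E hEA κ al ξ ρ ξ hξ
      (fun t ht j hj1 hjL => by rw [hκ]; simp)
      (fun t ht h1 => by rw [hκ] at h1; exact absurd h1 (by norm_num))
      (fun t' ht' _ => by
        by_cases htq' : t' = q
        · subst htq'; rw [halq]; exact ⟨hiL, hPa, hPa1, hPfree⟩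
        by_cases htz' : t' = z
        · subst htz'; rw [halz]; exact ⟨hcL, hQc, hQc1, hQfree⟩
        rw [halo t' htq' htz']
        refine ⟨Nat.lt_of_lt_of_le Nat.zero_lt_one (hL t' ht'), fun j hj1 hj0 => by omega, fun h => by omega, fun j hj1 hjL _ => ?_⟩
        have hx : e t' j ∈ E := hAE t' ht' (heA t' ht' j hj1 hjL)
        exact hrest (e t' j) hx (fun hm => Finset.disjoint_left.mp (hAdisj t' q ht' hq htq') (heA t' ht' j hj1 hjL) hm)
          (fun hm => Finset.disjoint_left.mp (hAdisj t' z ht' hz htz') (heA t' ht' j hj1 hjL) hm))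
      (fun t ht => by rw [hκ]; exact Or.inr (Or.inr rfl)) hnf hempty
    obtain ⟨hbX, hbY, T2, T3⟩ := key
    -- thread `t` is blue in `ρ`, hence red in `ξ`
    have hAt : A t ⊆ ξ := by
      intro x hx
      obtain ⟨j, hj1, hjL, rfl⟩ := (hA t ht x).mp hx
      have hxE : e t j ∈ E := hAE t ht hx
      have hnρ : e t j ∉ ρ := fun hm => Finset.disjoint_left.mp hk.1.2 hx hm
      by_contra hnξ
      exact hnρ ((hrest (e t j) hxE (fun hm => Finset.disjoint_left.mp (hAdisj t q ht hq htq) hx hm)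
        (fun hm => Finset.disjoint_left.mp (hAdisj t z ht hz htz) hx hm)).mpr hnξ)
    have hsub : ξ \ A t ⊆ ξ := Finset.sdiff_subset
    refine ⟨hAt, ⟨hv.2, (hQc1 hc1).1⟩, ⟨(hPa 1 (le_refl 1) hi1).1, fun hsub' => (hPa1 hi1).1 (hsub' (heA q hq (i + 1) (by omega) (by omega)))⟩,
      hv.1, hh, ⟨hbX, hbY⟩, ⟨one_of_ge ha ha01 _ _ (Cmono _ _ hsub) mha hh.1, one_of_ge kb kb01 _ _ T2 mkb hk.1.1.1,
      zero_of_le hb hb01 _ _ (Ccompl _ _ hsub) mhb hh.2, zero_of_le ka ka01 _ _ T3 mka hk.1.1.2⟩⟩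
  -- ## the abstract theorem
  have key := fibre_system_count E (A q) (A z) (hAE q hq) (hAE z hz) (hAdisj q z hq hz hqz) (L q) (L z) (hL q hq) (hL z hz) (e q) (e z)
    (heA q hq) (einj q hq) (fun x hx => (hA q hq x).mp hx) (heA z hz) (einj z hz) (fun x hx => (hA z hz x).mp hx)
    (fun ξ => 𝒱 (ξ \ A t) ∧ ∀ j, 1 ≤ j → j ≤ a → e z j ∈ ξ) (fun ξ => ha (C (ξ \ A t)) = 1 ∧ hb (C (E \ (ξ \ A t))) = 0)
    (fun ξ => ((kb (C (E \ ξ)) = 1 ∧ ka (C ξ) = 0) ∧ Disjoint (A t) ξ) ∧ e z (a + 1) ∉ ξ)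
    (fun ξ => b ∈ C (E \ ξ) ∧ b ∉ C ξ)
    (fun lam => A t ⊆ lam ∧ ((∀ j, 1 ≤ j → j ≤ a → e z j ∈ lam) ∧ e z (a + 1) ∉ lam) ∧ (e q 1 ∈ lam ∧ ¬ A q ⊆ lam) ∧ 𝒱 (lam \ A t) ∧
      (ha (C (lam \ A t)) = 1 ∧ hb (C (E \ (lam \ A t))) = 0) ∧ (b ∈ C lam ∧ b ∉ C (E \ lam)) ∧
      (ha (C lam) = 1 ∧ kb (C lam) = 1 ∧ hb (C (E \ lam)) = 0 ∧ ka (C (E \ lam)) = 0))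
    V'_mono hro_mono kbo_anti N_anti hNPQ (Finset.Icc 1 (L q - 1)) (Finset.Icc 1 (L z - 1)) (Or.inr rfl) (Or.inr rfl) covP' covQ' transfer
  -- the source sets agree: a `t`-blue colouring is its own pre-lift
  have e1 : (E.powerset).filter (fun σ => Disjoint (A t) σ ∧ ((∀ j, 1 ≤ j → j ≤ a → e z j ∈ σ) ∧ e z (a + 1) ∉ σ) ∧ 𝒱 σ ∧
      (b ∈ C (E \ σ) ∧ b ∉ C σ) ∧ (ha (C σ) = 1 ∧ hb (C (E \ σ)) = 0) ∧ (kb (C (E \ σ)) = 1 ∧ ka (C σ) = 0)) =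
      (E.powerset).filter (fun σ => (𝒱 (σ \ A t) ∧ ∀ j, 1 ≤ j → j ≤ a → e z j ∈ σ) ∧ (b ∈ C (E \ σ) ∧ b ∉ C σ) ∧
        (ha (C (σ \ A t)) = 1 ∧ hb (C (E \ (σ \ A t))) = 0) ∧ (((kb (C (E \ σ)) = 1 ∧ ka (C σ) = 0) ∧ Disjoint (A t) σ) ∧ e z (a + 1) ∉ σ)) := by
    apply Finset.filter_congr
    intro σ _
    constructor
    · rintro ⟨hd, ⟨hcl, hna⟩, hv, hN, hh, hk⟩
      rw [sdiff_of_disj σ hd]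
      exact ⟨⟨hv, hcl⟩, hN, hh, ⟨hk, hd⟩, hna⟩
    · rintro ⟨⟨hv, hcl⟩, hN, hh, ⟨hk, hd⟩, hna⟩
      rw [sdiff_of_disj σ hd] at hv hh
      exact ⟨hd, ⟨hcl, hna⟩, hv, hN, hh, hk⟩
  have e2 : ((E.powerset).filter (fun σ => Disjoint (A t) σ ∧ ((∀ j, 1 ≤ j → j ≤ a → e z j ∈ σ) ∧ e z (a + 1) ∉ σ) ∧ 𝒱 σ ∧
      (b ∈ C (E \ σ) ∧ b ∉ C σ) ∧ (ha (C σ) = 1 ∧ hb (C (E \ σ)) = 0) ∧ (kb (C (E \ σ)) = 1 ∧ ka (C σ) = 0))).card ≤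
      ((E.powerset).filter (fun lam => A t ⊆ lam ∧ ((∀ j, 1 ≤ j → j ≤ a → e z j ∈ lam) ∧ e z (a + 1) ∉ lam) ∧ (e q 1 ∈ lam ∧ ¬ A q ⊆ lam) ∧
      𝒱 (lam \ A t) ∧ (ha (C (lam \ A t)) = 1 ∧ hb (C (E \ (lam \ A t))) = 0) ∧ (b ∈ C lam ∧ b ∉ C (E \ lam)) ∧
      (ha (C lam) = 1 ∧ kb (C lam) = 1 ∧ hb (C (E \ lam)) = 0 ∧ ka (C (E \ lam)) = 0))).card := by
    rw [e1]; convert key using 3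
  convert e2 using 3

end Coefficientwise

end Summit.CriticalPhenomena.PercolationContinuityZ3.Theorems
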